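import Literature.NumberTheory.Automorphic.BrandtModule
import Literature.NumberTheory.Automorphic.MatrixRightIdeals
import Mathlib.RingTheory.Noetherian.Basic
import HarnessLib

/-!
# Invertible sub-ideals of index `p²` of an order with residue ring `M₂(𝔽_p)`: there are `p + 1`

Topic `NumberTheory/Automorphic`. The local computation behind the degree `p + 1` of the Brandt
matrix `T(p)` at a prime `p` not dividing the level (Eichler 1973, II §6 (16): the row sums of
`B(p)` are `p + 1`; Vignéras III §5 Ex. 5.8 (a); Voight 26.4: sub-ideals of norm `p` of `O_p ≅
M₂(ℤ_p)` are the `p + 1` right ideals `x M₂(ℤ_p)`, `nrd x = p`), carried out with a **residue map**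
instead of a completion: a map `ψ : B → M₂(F)`, `F` a field with `p` elements, which on the
`ℤ`-order `O` is a surjective unital ring homomorphism with kernel `p O`
(`IsMatrixResidueMap O p ψ`; for a maximal order at a split prime such a `ψ` is provided by the
tree's `exists_modPow_reduction`, `EichlerOrderPadicSplitting.lean`).

## Main results (namespace `Literature.NumberTheory.Automorphic.IsMatrixResidueMap`)

* `preim h S` — the lattice `{x ∈ O : ψ x ∈ S}` for an additive subgroup `S ⊆ M₂(F)`;
  `relIndex_preim`: `[O : preim S] = [M₂(F) : S]`.
* `isInvertibleRightIdeal_idealOf` — **for every subspace `U ≤ F²` the lattice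
  `idealOf h U = M_U = ψ⁻¹(J_U) ∩ O` is an invertible right `O`-ideal** (`J_U` = matrices with columns in `U`,
  `MatrixRightIdeals.lean`), with the explicit inverse `M' = {x : p x ∈ ψ⁻¹(K_U) ∩ O}`, `K_U` the
  left annihilator of `U`: `M' M_U = O` and `M_U M' = O_ℓ(M_U)` follow from `K_U J_U = 0`, `ker ψ =
  p O` and a projection `E ∈ J_U`, `1 - E ∈ K_U` (`1 = e · 1 + p · p⁻¹(1 - e)`).
* `finrank_eq_one_and_eq_idealOf` — conversely **every right `O`-module `M ⊆ O` of index
  `p²` is `M_L` for the line `L =` column space of `ψ(M)`**: `ψ(M)` is a right ideal of `M₂(F)`,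
  of cardinality `p^{2d}`; `d = 0` is excluded by `[O : M] = p²`, and `d = 2` would give `m ∈ M`
  with `ψ m = 1`, `m = 1 - p y`, whence `1 = m (1 + p y) + p² y² ∈ M`.
* `subidealEquivLines`, `natCard_subideals_eq` — hence **`#{M ⊆ O invertible right O-ideal :
  [O : M] = p²} = p + 1`**, the number of lines in `F²` (`MatrixRightIdeal.natCard_lines`).

## References

* M. Eichler, LNM 320 (1973), Ch. II §6 (16) [Eichler1973].
* M.-F. Vignéras, LNM 800 (1980), Ch. II §2 (ordres de `M(2, K)`), Ch. III §5 Ex. 5.8 (a)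
  [VignerasLNM800].
* J. Voight, *Quaternion Algebras*, GTM 288 (2021), §26.4 [Voight2021].
-/

noncomputable section

open scoped Pointwise Matrix

universe u

namespace Literature.NumberTheory.Automorphic

variable {B : Type u} [Ring B]

/-- A **matrix residue map modulo `p`** for the lattice `O ⊆ B`: a map `ψ : B → M₂(F)` which on
`O` is additive, multiplicative and unital, maps `O` onto `M₂(F)`, and has kernel `p O` on `O` —
i.e. induces a ring isomorphism `O / p O ≅ M₂(F)`. This is the shape in which the tree's
`exists_modPow_reduction` (`EichlerOrderPadicSplitting.lean`, `k = 1`) provides the reduction of a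
maximal order at a split prime (Vignéras II §2 Thm. 2.3 (1): `O_p ≅ M₂(ℤ_p)`). [folklore] -/
structure IsMatrixResidueMap (O : Submodule ℤ B) (p : ℕ) {F : Type*} [Field F]
    (ψ : B → Matrix (Fin 2) (Fin 2) F) : Prop where
  /-- `ψ` is additive on `O`. -/
  map_add : ∀ x ∈ O, ∀ y ∈ O, ψ (x + y) = ψ x + ψ y
  /-- `ψ` is multiplicative on `O`. -/
  map_mul : ∀ x ∈ O, ∀ y ∈ O, ψ (x * y) = ψ x * ψ y
  /-- `ψ` is unital. -/
  map_one : ψ 1 = 1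
  /-- `ψ` maps `O` onto `M₂(F)`. -/
  surj : ∀ m, ∃ x ∈ O, ψ x = m
  /-- The kernel of `ψ` on `O` is `p O`. -/
  ker : ∀ x ∈ O, ψ x = 0 ↔ ∃ y ∈ O, x = (p : ℤ) • y

namespace IsMatrixResidueMap

variable {O : Submodule ℤ B} {p : ℕ} {F : Type*} [Field F] {ψ : B → Matrix (Fin 2) (Fin 2) F}

/-! ### The residue map as an additive homomorphism on `O` -/

/-- `ψ 0 = 0`. [folklore] -/
theorem map_zero (h : IsMatrixResidueMap O p ψ) : ψ 0 = 0 := by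
  have := h.map_add 0 O.zero_mem 0 O.zero_mem
  rw [add_zero] at this
  exact left_eq_add.mp this

/-- `ψ` restricted to `O`, as an additive monoid homomorphism `O →+ M₂(F)`. [folklore] -/
def addHom (h : IsMatrixResidueMap O p ψ) : O →+ Matrix (Fin 2) (Fin 2) F where
  toFun x := ψ x
  map_zero' := h.map_zero
  map_add' x y := h.map_add x x.2 y y.2

/-- `addHom` is `ψ` (definitional). [folklore] -/
@[simp] theorem addHom_apply (h : IsMatrixResidueMap O p ψ) (x : O) : h.addHom x = ψ x := rfl

/-- `ψ` maps `O` onto `M₂(F)`. [folklore] -/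
theorem addHom_surjective (h : IsMatrixResidueMap O p ψ) : Function.Surjective h.addHom :=
  fun m => by obtain ⟨x, hx, rfl⟩ := h.surj m; exact ⟨⟨x, hx⟩, rfl⟩

/-- `ψ (n • x) = n • ψ x` on `O`. [folklore] -/
theorem map_zsmul (h : IsMatrixResidueMap O p ψ) {x : B} (hx : x ∈ O) (n : ℤ) :
    ψ (n • x) = n • ψ x :=
  _root_.map_zsmul h.addHom n ⟨x, hx⟩

/-- `ψ (x - y) = ψ x - ψ y` on `O`. [folklore] -/
theorem map_sub (h : IsMatrixResidueMap O p ψ) {x y : B} (hx : x ∈ O) (hy : y ∈ O) :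
    ψ (x - y) = ψ x - ψ y :=
  _root_.map_sub h.addHom ⟨x, hx⟩ ⟨y, hy⟩

/-- `ψ (p y) = 0` for `y ∈ O`. [folklore] -/
theorem map_smul_eq_zero (h : IsMatrixResidueMap O p ψ) {y : B} (hy : y ∈ O) :
    ψ ((p : ℤ) • y) = 0 :=
  (h.ker _ (O.smul_mem _ hy)).mpr ⟨y, hy, rfl⟩

/-! ### Preimage lattices and their index -/

/-- The **preimage lattice** `{x ∈ O : ψ x ∈ S}` of an additive subgroup `S ⊆ M₂(F)`. [folklore] -/
def preim (h : IsMatrixResidueMap O p ψ) (S : AddSubgroup (Matrix (Fin 2) (Fin 2) F)) :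
    Submodule ℤ B where
  carrier := {x | x ∈ O ∧ ψ x ∈ S}
  add_mem' {x y} hx hy := ⟨O.add_mem hx.1 hy.1, by rw [h.map_add x hx.1 y hy.1]; exact S.add_mem hx.2 hy.2⟩
  zero_mem' := ⟨O.zero_mem, by rw [h.map_zero]; exact S.zero_mem⟩
  smul_mem' n {x} hx := ⟨O.smul_mem n hx.1, by rw [h.map_zsmul hx.1]; exact S.zsmul_mem hx.2 n⟩

/-- Membership in the preimage lattice (definitional). [folklore] -/
theorem mem_preim_iff (h : IsMatrixResidueMap O p ψ) {S : AddSubgroup (Matrix (Fin 2) (Fin 2) F)}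
    {x : B} : x ∈ h.preim S ↔ x ∈ O ∧ ψ x ∈ S := Iff.rfl

/-- `preim S ⊆ O`. [folklore] -/
theorem preim_le (h : IsMatrixResidueMap O p ψ) (S : AddSubgroup (Matrix (Fin 2) (Fin 2) F)) :
    h.preim S ≤ O := fun _ hx => hx.1

/-- `p O ⊆ preim S`. [folklore] -/
theorem smul_mem_preim (h : IsMatrixResidueMap O p ψ) (S : AddSubgroup (Matrix (Fin 2) (Fin 2) F))
    {y : B} (hy : y ∈ O) : (p : ℤ) • y ∈ h.preim S :=
  ⟨O.smul_mem _ hy, by rw [h.map_smul_eq_zero hy]; exact S.zero_mem⟩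

/-- **`[O : preim S] = [M₂(F) : S]`** (`ψ` maps `O` onto `M₂(F)` and `preim S` is the full
preimage). [folklore] -/
theorem relIndex_preim (h : IsMatrixResidueMap O p ψ) (S : AddSubgroup (Matrix (Fin 2) (Fin 2) F)) :
    (h.preim S).toAddSubgroup.relIndex O.toAddSubgroup = S.index := by
  rw [AddSubgroup.relIndex]
  have : (h.preim S).toAddSubgroup.addSubgroupOf O.toAddSubgroup = S.comap h.addHom := by
    ext x
    rw [AddSubgroup.mem_addSubgroupOf, AddSubgroup.mem_comap]
    exact ⟨fun hx => hx.2, fun hx => ⟨x.2, hx⟩⟩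
  rw [this]
  exact S.index_comap_of_surjective h.addHom_surjective

/-! ### The invertible ideal of a subspace -/

section Invertible

/-- The lattice `M_U = {x ∈ O : ψ x ∈ J_U}` of a subspace `U ≤ F²` (`J_U` the right ideal of
matrices with columns in `U`). [folklore] -/
abbrev idealOf (h : IsMatrixResidueMap O p ψ) (U : Submodule F (Fin 2 → F)) : Submodule ℤ B :=
  h.preim (MatrixRightIdeal.rightIdealOf (Fin 2) U).toAddSubgroup

/-- The lattice `N_U = {x ∈ O : ψ x ∈ K_U}` (`K_U` the left annihilator of `U`). [folklore] -/
abbrev annOf (h : IsMatrixResidueMap O p ψ) (U : Submodule F (Fin 2 → F)) : Submodule ℤ B :=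
  h.preim (MatrixRightIdeal.leftAnnOf (Fin 2) U).toAddSubgroup

/-- The inverse lattice `M'_U = {x : p x ∈ N_U}` (`= p⁻¹ N_U`). [folklore] -/
def invOf (h : IsMatrixResidueMap O p ψ) (U : Submodule F (Fin 2 → F)) : Submodule ℤ B :=
  (h.annOf U).comap (DistribSMul.toLinearMap ℤ B (p : ℤ))

/-- Membership in `M'_U` (definitional). [folklore] -/
theorem mem_invOf_iff (h : IsMatrixResidueMap O p ψ) {U : Submodule F (Fin 2 → F)} {x : B} :
    x ∈ h.invOf U ↔ (p : ℤ) • x ∈ h.annOf U := Iff.rfl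

/-- `M_U` is a right `O`-module. [folklore] -/
theorem mul_mem_idealOf (h : IsMatrixResidueMap O p ψ) (hO : IsZOrder O) {U : Submodule F (Fin 2 → F)}
    {m a : B} (hm : m ∈ h.idealOf U) (ha : a ∈ O) : m * a ∈ h.idealOf U := by
  refine ⟨hO.mul_mem m hm.1 a ha, ?_⟩
  rw [h.map_mul m hm.1 a ha]
  have := (MatrixRightIdeal.rightIdealOf (Fin 2) U).smul_mem (MulOpposite.op (ψ a)) hm.2
  rwa [MulOpposite.smul_eq_mul_unop, MulOpposite.unop_op] at this

/-- `N_U M_U ⊆ p O`: `ψ (x y) = ψ x ψ y ∈ K_U J_U = 0`. [folklore] -/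
theorem exists_eq_smul_of_mem_annOf_of_mem_idealOf (h : IsMatrixResidueMap O p ψ) (hO : IsZOrder O)
    {U : Submodule F (Fin 2 → F)} {x y : B} (hx : x ∈ h.annOf U) (hy : y ∈ h.idealOf U) :
    ∃ w ∈ O, x * y = (p : ℤ) • w := by
  have hxy : x * y ∈ O := hO.mul_mem x hx.1 y hy.1
  refine (h.ker _ hxy).mp ?_
  rw [h.map_mul x hx.1 y hy.1]
  exact MatrixRightIdeal.mul_eq_zero_of_mem hx.2 hy.2

/-- `M_U O ⊆ M_U`. [folklore] -/
theorem idealOf_mul_order_le (h : IsMatrixResidueMap O p ψ) (hO : IsZOrder O)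
    (U : Submodule F (Fin 2 → F)) : h.idealOf U * O ≤ h.idealOf U :=
  Submodule.mul_le.mpr fun _ hm _ ha => h.mul_mem_idealOf hO hm ha

/-- `O_ℓ(M_U) M_U ⊆ M_U`. [folklore] -/
theorem leftOrderOf_mul_idealOf_le (h : IsMatrixResidueMap O p ψ) (U : Submodule F (Fin 2 → F)) :
    leftOrderOf (h.idealOf U) * h.idealOf U ≤ h.idealOf U :=
  Submodule.mul_le.mpr fun _ hz _ hw => hz _ hw

/-- A lift `e ∈ O` of a projection onto `U`: `ψ e ∈ J_U` and `1 - ψ e ∈ K_U`. [folklore] -/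
theorem exists_lift_proj (h : IsMatrixResidueMap O p ψ) (U : Submodule F (Fin 2 → F)) :
    ∃ e ∈ O, ψ e ∈ MatrixRightIdeal.rightIdealOf (Fin 2) U ∧
      1 - ψ e ∈ MatrixRightIdeal.leftAnnOf (Fin 2) U := by
  obtain ⟨E, hE, hE'⟩ := MatrixRightIdeal.exists_proj U
  obtain ⟨e, he, rfl⟩ := h.surj E
  exact ⟨e, he, hE, hE'⟩

/-- For a lift `e` of a projection onto `U`: `1 - e ∈ N_U`. [folklore] -/
theorem one_sub_mem_annOf (h : IsMatrixResidueMap O p ψ) (hO : IsZOrder O)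
    {U : Submodule F (Fin 2 → F)} {e : B} (he : e ∈ O)
    (hE' : 1 - ψ e ∈ MatrixRightIdeal.leftAnnOf (Fin 2) U) : 1 - e ∈ h.annOf U := by
  refine ⟨O.sub_mem hO.one_mem he, ?_⟩
  rw [h.map_sub hO.one_mem he, h.map_one]
  exact hE'

/-- `1 ∈ M'_U` (as `ψ (p · 1) = 0 ∈ K_U`). [folklore] -/
theorem one_mem_invOf (h : IsMatrixResidueMap O p ψ) (hO : IsZOrder O) (U : Submodule F (Fin 2 → F)) :
    (1 : B) ∈ h.invOf U :=
  h.smul_mem_preim _ hO.one_mem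

/-- `M_U` is a full lattice (it lies between `p O` and `O`). [folklore] -/
theorem isFullLattice_idealOf (h : IsMatrixResidueMap O p ψ) (hO : IsZOrder O) (hp : p ≠ 0)
    (U : Submodule F (Fin 2 → F)) : IsFullLattice B (h.idealOf U) := by
  refine ⟨Submodule.FG.of_le hO.isFullLattice.1 (h.preim_le _), fun d => ?_⟩
  obtain ⟨n, hn, hnd⟩ := hO.isFullLattice.2 d
  refine ⟨p * n, mul_ne_zero (by exact_mod_cast hp) hn, ?_⟩
  rw [mul_smul]
  exact h.smul_mem_preim _ hnd

variable [Algebra ℚ B]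

omit [Field F] in
/-- `p · (p⁻¹ x) = x` with the integer `p` acting on the `ℚ`-algebra `B`. [folklore] -/
theorem zsmul_inv_smul (hp : p ≠ 0) (x : B) : (p : ℤ) • ((p : ℚ)⁻¹ • x) = x := by
  rw [← Int.cast_smul_eq_zsmul ℚ, smul_smul, Int.cast_natCast,
    mul_inv_cancel₀ (by exact_mod_cast hp : (p : ℚ) ≠ 0), one_smul]

omit [Field F] in
/-- `(p⁻¹ x) · (p · 1) = x`. [folklore] -/
theorem inv_smul_mul_zsmul_one (hp : p ≠ 0) (x : B) :
    (p : ℚ)⁻¹ • x * ((p : ℤ) • (1 : B)) = x := by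
  rw [← Int.cast_smul_eq_zsmul ℚ (p : ℤ) (1 : B), smul_mul_smul_comm, mul_one, Int.cast_natCast,
    inv_mul_cancel₀ (by exact_mod_cast hp : (p : ℚ) ≠ 0), one_smul]

omit [Field F] in
/-- `(p · 1) · (p⁻¹ x) = x`. [folklore] -/
theorem zsmul_one_mul_inv_smul (hp : p ≠ 0) (x : B) :
    (p : ℤ) • (1 : B) * ((p : ℚ)⁻¹ • x) = x := by
  rw [← Int.cast_smul_eq_zsmul ℚ (p : ℤ) (1 : B), smul_mul_smul_comm, one_mul, Int.cast_natCast,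
    mul_inv_cancel₀ (by exact_mod_cast hp : (p : ℚ) ≠ 0), one_smul]

/-- For a lift `e` of a projection onto `U`: `p⁻¹ (1 - e) ∈ M'_U`. [folklore] -/
theorem inv_smul_one_sub_mem_invOf (h : IsMatrixResidueMap O p ψ) (hO : IsZOrder O) (hp : p ≠ 0)
    {U : Submodule F (Fin 2 → F)} {e : B} (he : e ∈ O)
    (hE' : 1 - ψ e ∈ MatrixRightIdeal.leftAnnOf (Fin 2) U) :
    (p : ℚ)⁻¹ • (1 - e) ∈ h.invOf U := by
  rw [mem_invOf_iff, zsmul_inv_smul hp]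
  exact h.one_sub_mem_annOf hO he hE'

/-- **`M'_U M_U = O`.** [folklore] -/
theorem invOf_mul_idealOf (h : IsMatrixResidueMap O p ψ) (hO : IsZOrder O) (hp : p ≠ 0)
    (U : Submodule F (Fin 2 → F)) : h.invOf U * h.idealOf U = O := by
  haveI : IsAddTorsionFree B := isAddTorsionFree_of_charZero_module ℚ B
  apply le_antisymm
  · rw [Submodule.mul_le]
    intro x hx y hy
    have hx' : (p : ℤ) • x ∈ h.annOf U := hx
    obtain ⟨w, hw, hxy⟩ := h.exists_eq_smul_of_mem_annOf_of_mem_idealOf hO hx' hy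
    rw [smul_mul_assoc] at hxy
    have hp' : (p : ℤ) ≠ 0 := by exact_mod_cast hp
    rw [smul_right_injective B hp' hxy]
    exact hw
  · obtain ⟨e, he, hE, hE'⟩ := h.exists_lift_proj U
    have h1 : (1 : B) ∈ h.invOf U * h.idealOf U := by
      have heq : (1 : B) = (p : ℚ)⁻¹ • (1 - e) * ((p : ℤ) • (1 : B)) + 1 * e := by
        rw [inv_smul_mul_zsmul_one hp, one_mul, sub_add_cancel]
      rw [heq]
      exact add_mem (Submodule.mul_mem_mul (h.inv_smul_one_sub_mem_invOf hO hp he hE')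
        (h.smul_mem_preim _ hO.one_mem)) (Submodule.mul_mem_mul (h.one_mem_invOf hO U) ⟨he, hE⟩)
    intro a ha
    have hmem : 1 * a ∈ h.invOf U * h.idealOf U * O := Submodule.mul_mem_mul h1 ha
    rw [one_mul, mul_assoc] at hmem
    exact mul_le_mul' le_rfl (h.idealOf_mul_order_le hO U) hmem

/-- **`M_U M'_U = O_ℓ(M_U)`.** [folklore] -/
theorem idealOf_mul_invOf (h : IsMatrixResidueMap O p ψ) (hO : IsZOrder O) (hp : p ≠ 0)
    (U : Submodule F (Fin 2 → F)) : h.idealOf U * h.invOf U = leftOrderOf (h.idealOf U) := by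
  apply le_antisymm
  · intro z hz m hm
    have hmem : z * m ∈ h.idealOf U * h.invOf U * h.idealOf U := Submodule.mul_mem_mul hz hm
    rw [mul_assoc, h.invOf_mul_idealOf hO hp U] at hmem
    exact h.idealOf_mul_order_le hO U hmem
  · obtain ⟨e, he, hE, hE'⟩ := h.exists_lift_proj U
    have h1 : (1 : B) ∈ h.idealOf U * h.invOf U := by
      have heq : (1 : B) = e * 1 + (p : ℤ) • (1 : B) * ((p : ℚ)⁻¹ • (1 - e)) := by
        rw [zsmul_one_mul_inv_smul hp, mul_one, add_sub_cancel]
      rw [heq]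
      exact add_mem (Submodule.mul_mem_mul ⟨he, hE⟩ (h.one_mem_invOf hO U))
        (Submodule.mul_mem_mul (h.smul_mem_preim _ hO.one_mem)
          (h.inv_smul_one_sub_mem_invOf hO hp he hE'))
    intro x hx
    have hmem : x * 1 ∈ leftOrderOf (h.idealOf U) * (h.idealOf U * h.invOf U) :=
      Submodule.mul_mem_mul hx h1
    rw [mul_one, ← mul_assoc] at hmem
    exact mul_le_mul' (h.leftOrderOf_mul_idealOf_le U) le_rfl hmem

/-- **The right order of `M_U` is `O`.** [folklore] -/
theorem rightOrderOf_idealOf (h : IsMatrixResidueMap O p ψ) (hO : IsZOrder O) (hp : p ≠ 0)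
    (U : Submodule F (Fin 2 → F)) : rightOrderOf (h.idealOf U) = O := by
  apply le_antisymm
  · intro x hx
    have hle : h.invOf U * h.idealOf U ≤ O.comap (LinearMap.mulRight ℤ x) := by
      rw [Submodule.mul_le]
      intro l' hl' l hl
      change l' * l * x ∈ O
      rw [mul_assoc, ← h.invOf_mul_idealOf hO hp U]
      exact Submodule.mul_mem_mul hl' (hx l hl)
    have h1 : (1 : B) ∈ h.invOf U * h.idealOf U := (h.invOf_mul_idealOf hO hp U).symm ▸ hO.one_mem
    simpa using hle h1
  · intro a ha m hm
    exact h.mul_mem_idealOf hO hm ha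

/-- **`M_U` is an invertible right `O`-ideal**, for every subspace `U ≤ F²`. [folklore] -/
theorem isInvertibleRightIdeal_idealOf (h : IsMatrixResidueMap O p ψ) (hO : IsZOrder O) (hp : p ≠ 0)
    (U : Submodule F (Fin 2 → F)) : IsInvertibleRightIdeal O (h.idealOf U) :=
  ⟨h.isFullLattice_idealOf hO hp U, h.rightOrderOf_idealOf hO hp U,
    ⟨h.invOf U, h.idealOf_mul_invOf hO hp U, h.invOf_mul_idealOf hO hp U⟩⟩

end Invertible

/-! ### Indices and the image of a sub-ideal -/

section Count

variable [Fintype F]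

omit [Ring B] [Field F] in
/-- `|M₂(F)| = q⁴`. [folklore] -/
theorem natCard_matrix_fin_two : Nat.card (Matrix (Fin 2) (Fin 2) F) = Fintype.card F ^ 4 := by
  rw [show Nat.card (Matrix (Fin 2) (Fin 2) F) = Nat.card (Fin 2 → Fin 2 → F) from rfl,
    Nat.card_fun, Nat.card_fun, Nat.card_eq_fintype_card (α := F), Nat.card_eq_fintype_card,
    Fintype.card_fin, ← pow_mul]

omit [Ring B] in
/-- `[M₂(F) : J_U] · q^{2 dim U} = q⁴`. [folklore] -/
theorem index_rightIdealOf_mul (U : Submodule F (Fin 2 → F)) :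
    (MatrixRightIdeal.rightIdealOf (Fin 2) U).toAddSubgroup.index *
        Fintype.card F ^ (2 * Module.finrank F U) = Fintype.card F ^ 4 := by
  have h := (MatrixRightIdeal.rightIdealOf (Fin 2) U).toAddSubgroup.index_mul_card
  rw [natCard_matrix_fin_two] at h
  rw [← h]
  congr 1
  change _ = Nat.card (MatrixRightIdeal.rightIdealOf (Fin 2) U)
  rw [MatrixRightIdeal.natCard_rightIdealOf, MatrixRightIdeal.natCard_submodule_eq_pow,
    Fintype.card_fin, ← pow_mul, mul_comm]

/-- **`[O : M_U] · q^{2 dim U} = q⁴`**; in particular `[O : M_L] = q²` for a line `L`. [folklore] -/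
theorem relIndex_idealOf_mul (h : IsMatrixResidueMap O p ψ) (U : Submodule F (Fin 2 → F)) :
    (h.idealOf U).toAddSubgroup.relIndex O.toAddSubgroup * Fintype.card F ^ (2 * Module.finrank F U) =
      Fintype.card F ^ 4 := by
  rw [idealOf, h.relIndex_preim, index_rightIdealOf_mul]

/-- `[O : M_L] = q²` for a line `L`. [folklore] -/
theorem relIndex_idealOf_of_finrank_eq_one (h : IsMatrixResidueMap O p ψ) {U : Submodule F (Fin 2 → F)}
    (hU : Module.finrank F U = 1) :
    (h.idealOf U).toAddSubgroup.relIndex O.toAddSubgroup = Fintype.card F ^ 2 := by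
  have hq : 0 < Fintype.card F ^ 2 := pow_pos Fintype.card_pos 2
  have h4 := h.relIndex_idealOf_mul U
  rw [hU, mul_one, show Fintype.card F ^ 4 = Fintype.card F ^ 2 * Fintype.card F ^ 2 by ring] at h4
  exact Nat.eq_of_mul_eq_mul_right hq h4

omit [Fintype F] in
/-- **The image `ψ(M)` of a right `O`-module `M ⊆ O` is a right ideal of `M₂(F)`** (`ψ` maps `O`
onto `M₂(F)`). [folklore] -/
def imageOf (h : IsMatrixResidueMap O p ψ) {M : Submodule ℤ B} (hMO : M ≤ O)
    (hmul : ∀ m ∈ M, ∀ a ∈ O, m * a ∈ M) :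
    Submodule (Matrix (Fin 2) (Fin 2) F)ᵐᵒᵖ (Matrix (Fin 2) (Fin 2) F) where
  carrier := {A | ∃ m ∈ M, ψ m = A}
  zero_mem' := ⟨0, M.zero_mem, h.map_zero⟩
  add_mem' := by
    rintro _ _ ⟨m, hm, rfl⟩ ⟨m', hm', rfl⟩
    exact ⟨m + m', M.add_mem hm hm', h.map_add m (hMO hm) m' (hMO hm')⟩
  smul_mem' X := by
    rintro _ ⟨m, hm, rfl⟩
    obtain ⟨a, ha, hXa⟩ := h.surj X.unop
    refine ⟨m * a, hmul m hm a ha, ?_⟩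
    rw [h.map_mul m (hMO hm) a ha, hXa, MulOpposite.smul_eq_mul_unop]

omit [Fintype F] in
/-- Membership in `ψ(M)` (definitional). [folklore] -/
theorem mem_imageOf_iff (h : IsMatrixResidueMap O p ψ) {M : Submodule ℤ B} (hMO : M ≤ O)
    (hmul : ∀ m ∈ M, ∀ a ∈ O, m * a ∈ M) {A : Matrix (Fin 2) (Fin 2) F} :
    A ∈ h.imageOf hMO hmul ↔ ∃ m ∈ M, ψ m = A := Iff.rfl

omit [Fintype F] in
/-- `M ⊆ ψ⁻¹(ψ(M)) ∩ O`. [folklore] -/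
theorem le_preim_imageOf (h : IsMatrixResidueMap O p ψ) {M : Submodule ℤ B} (hMO : M ≤ O)
    (hmul : ∀ m ∈ M, ∀ a ∈ O, m * a ∈ M) : M ≤ h.preim (h.imageOf hMO hmul).toAddSubgroup :=
  fun m hm => ⟨hMO hm, m, hm, rfl⟩

omit [Fintype F] in
/-- `ψ(M_U) = J_U`. [folklore] -/
theorem imageOf_idealOf (h : IsMatrixResidueMap O p ψ) (U : Submodule F (Fin 2 → F))
    (hmul : ∀ m ∈ h.idealOf U, ∀ a ∈ O, m * a ∈ h.idealOf U) :
    h.imageOf (h.preim_le _) hmul = MatrixRightIdeal.rightIdealOf (Fin 2) U := by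
  ext A
  rw [mem_imageOf_iff]
  constructor
  · rintro ⟨m, hm, rfl⟩
    exact hm.2
  · intro hA
    obtain ⟨x, hx, rfl⟩ := h.surj A
    exact ⟨x, ⟨hx, hA⟩, rfl⟩

/-- **An invertible right `O`-ideal `M ⊆ O` of index `p²` is `M_L` for the line
`L = colSpan ψ(M)`** (`F` with `p` elements). Let `d = dim colSpan ψ(M)`, so `|ψ(M)| = p^{2d}`
and `[O : ψ⁻¹ψ(M)] = p^{4 - 2d}` divides `[O : M] = p²`: `d = 0` is impossible, and `d = 2` gives
`m ∈ M` with `ψ m = 1`, i.e. `1 - m = p y`, whence `1 = m (1 + p y) + p² y² ∈ M` and `M = O`,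
contradicting `[O : M] = p²`; so `d = 1`, and then `[O : M_L] = p² = [O : M]` with `M ⊆ M_L`
forces `M = M_L`. Only `M O ⊆ M` is used, not invertibility. [folklore] -/
theorem finrank_eq_one_and_eq_idealOf (h : IsMatrixResidueMap O p ψ) (hO : IsZOrder O)
    (hp : p.Prime) (hcard : Fintype.card F = p) {M : Submodule ℤ B} (hMO : M ≤ O)
    (hmul : ∀ m ∈ M, ∀ a ∈ O, m * a ∈ M)
    (hidx : M.toAddSubgroup.relIndex O.toAddSubgroup = p ^ 2) :
    Module.finrank F (MatrixRightIdeal.colSpan (h.imageOf hMO hmul)) = 1 ∧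
      M = h.idealOf (MatrixRightIdeal.colSpan (h.imageOf hMO hmul)) := by
  set J := h.imageOf hMO hmul with hJ
  set U := MatrixRightIdeal.colSpan J with hUdef
  have hJU : MatrixRightIdeal.rightIdealOf (Fin 2) U = J := MatrixRightIdeal.rightIdealOf_colSpan J
  have hPdef : h.idealOf U = h.preim J.toAddSubgroup := by rw [idealOf, hJU]
  have hMP : M ≤ h.idealOf U := hPdef ▸ h.le_preim_imageOf hMO hmul
  have hPO : h.idealOf U ≤ O := h.preim_le _
  -- indices
  have hmulidx := AddSubgroup.relIndex_mul_relIndex (H := M.toAddSubgroup)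
    (K := (h.idealOf U).toAddSubgroup) (L := O.toAddSubgroup) hMP hPO
  rw [hidx] at hmulidx
  have h4 := h.relIndex_idealOf_mul U
  rw [hcard] at h4
  have hd : Module.finrank F U ≤ 2 := by
    have := MatrixRightIdeal.finrank_colSpan_le J
    rwa [Fintype.card_fin] at this
  have hppos : 0 < p := hp.pos
  -- `d ≠ 0`
  have hd0 : Module.finrank F U ≠ 0 := by
    intro hd0
    rw [hd0, mul_zero, pow_zero, mul_one] at h4
    -- `[O : P] = p⁴` divides `p²`
    have hdvd : p ^ 4 ∣ p ^ 2 := ⟨M.toAddSubgroup.relIndex (h.idealOf U).toAddSubgroup, by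
      rw [← h4, ← hmulidx, mul_comm]⟩
    have := Nat.le_of_dvd (pow_pos hppos 2) hdvd
    have hlt : p ^ 2 < p ^ 4 := Nat.pow_lt_pow_right hp.one_lt (by norm_num)
    omega
  -- `d ≠ 2`
  have hd2 : Module.finrank F U ≠ 2 := by
    intro hd2
    rw [hd2, show 2 * 2 = 4 from rfl] at h4
    have hP1 : (h.idealOf U).toAddSubgroup.relIndex O.toAddSubgroup = 1 :=
      Nat.eq_of_mul_eq_mul_right (pow_pos hppos 4) (by rw [h4, one_mul])
    -- so `P = O`, `1 ∈ P`, `ψ m = 1` for some `m ∈ M`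
    have hOP : O ≤ h.idealOf U := fun x hx => (AddSubgroup.relIndex_eq_one.mp hP1) hx
    have h1P : (1 : B) ∈ h.preim J.toAddSubgroup := hPdef ▸ hOP hO.one_mem
    obtain ⟨m, hm, hm1⟩ := h1P.2
    -- `1 - m = p y`
    have hker : ψ (1 - m) = 0 := by rw [h.map_sub hO.one_mem (hMO hm), hm1, h.map_one, sub_self]
    obtain ⟨y, hy, hy1⟩ := (h.ker _ (O.sub_mem hO.one_mem (hMO hm))).mp hker
    -- `1 = m (1 + p y) + p² y² ∈ M`
    have hmeq : m = 1 - (p : ℤ) • y := by rw [← hy1, sub_sub_cancel]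
    have hring : ∀ a : B, (1 - a) * (1 + a) + a * a = 1 := fun a => by noncomm_ring
    have hkey : (1 : B) = m * (1 + (p : ℤ) • y) + ((p : ℤ) * p) • (y * y) := by
      rw [hmeq, ← smul_mul_smul_comm, hring]
    have h1M : (1 : B) ∈ M := by
      rw [hkey]
      refine M.add_mem (hmul m hm _ (O.add_mem hO.one_mem (O.smul_mem _ hy))) ?_
      have hsm := AddSubgroup.nsmul_relIndex_mem M.toAddSubgroup (K := O.toAddSubgroup)
        (hO.mul_mem y hy y hy)
      rw [hidx] at hsm
      have : ((p : ℤ) * p) • (y * y) = (p ^ 2 : ℕ) • (y * y) := by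
        rw [← natCast_zsmul]; congr 1; push_cast; ring
      rw [this]
      exact hsm
    -- hence `M = O`, contradiction with `[O : M] = p²`
    have hOM : O ≤ M := fun a ha => by simpa using hmul 1 h1M a ha
    have hMeq : M = O := le_antisymm hMO hOM
    rw [hMeq, AddSubgroup.relIndex_self] at hidx
    have : 1 < p ^ 2 := Nat.one_lt_pow (by norm_num) hp.one_lt
    omega
  have hd1 : Module.finrank F U = 1 := by omega
  refine ⟨hd1, ?_⟩
  -- `[O : P] = p²`, so `[P : M] = 1`
  rw [hd1, mul_one, show p ^ 4 = p ^ 2 * p ^ 2 by ring] at h4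
  have hP2 : (h.idealOf U).toAddSubgroup.relIndex O.toAddSubgroup = p ^ 2 :=
    Nat.eq_of_mul_eq_mul_right (pow_pos hppos 2) h4
  rw [hP2] at hmulidx
  have hM1 : M.toAddSubgroup.relIndex (h.idealOf U).toAddSubgroup = 1 :=
    Nat.eq_of_mul_eq_mul_right (pow_pos hppos 2) (by rw [hmulidx, one_mul])
  exact le_antisymm hMP fun x hx => (AddSubgroup.relIndex_eq_one.mp hM1) hx

variable [Algebra ℚ B]

/-- **Invertible sub-ideals of index `p²` ↔ lines in `F²`** (`F` with `p` elements):
`M ↦ colSpan ψ(M)`, with inverse `L ↦ M_L`. [folklore] -/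
def subidealEquivLines (h : IsMatrixResidueMap O p ψ) (hO : IsZOrder O) (hp : p.Prime)
    (hcard : Fintype.card F = p) :
    {M : invertibleRightIdeals O // (M : Submodule ℤ B) ≤ O ∧
        (M : Submodule ℤ B).toAddSubgroup.relIndex O.toAddSubgroup = p ^ 2} ≃
      {U : Submodule F (Fin 2 → F) // Module.finrank F U = 1} where
  toFun M := ⟨MatrixRightIdeal.colSpan (h.imageOf M.2.1 fun _ hm _ ha => M.1.2.mul_mem hm ha),
    (h.finrank_eq_one_and_eq_idealOf hO hp hcard M.2.1 (fun _ hm _ ha => M.1.2.mul_mem hm ha) M.2.2).1⟩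
  invFun U := ⟨⟨h.idealOf U.1, h.isInvertibleRightIdeal_idealOf hO hp.ne_zero U.1⟩, h.preim_le _,
    by rw [h.relIndex_idealOf_of_finrank_eq_one U.2, hcard]⟩
  left_inv M := by
    apply Subtype.ext; apply Subtype.ext
    exact (h.finrank_eq_one_and_eq_idealOf hO hp hcard M.2.1
      (fun _ hm _ ha => M.1.2.mul_mem hm ha) M.2.2).2.symm
  right_inv U := by
    apply Subtype.ext
    change MatrixRightIdeal.colSpan (h.imageOf (h.preim_le _) _) = U.1
    rw [h.imageOf_idealOf U.1, MatrixRightIdeal.colSpan_rightIdealOf]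

/-- **Eichler's local count.** If the `ℤ`-order `O` has a matrix residue map modulo the prime `p`
(a surjection `O → M₂(F)`, `|F| = p`, with kernel `p O`), then `O` has exactly **`p + 1`
invertible right sub-ideals of index `p²`** — the preimages of the `p + 1` right ideals of
`M₂(𝔽_p)` attached to the lines of `𝔽_p²` (Eichler 1973, II §6 (16); Vignéras III §5 Ex. 5.8 (a);
Voight 26.4). [cite: Eichler1973, Ch. II §6 (16)] -/
theorem natCard_subideals_eq (h : IsMatrixResidueMap O p ψ) (hO : IsZOrder O) (hp : p.Prime)
    (hcard : Fintype.card F = p) :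
    Nat.card {M : invertibleRightIdeals O // (M : Submodule ℤ B) ≤ O ∧
        (M : Submodule ℤ B).toAddSubgroup.relIndex O.toAddSubgroup = p ^ 2} = p + 1 := by
  rw [Nat.card_congr (h.subidealEquivLines hO hp hcard),
    MatrixRightIdeal.natCard_lines (Fintype.card_fin 2), hcard]

end Count

end IsMatrixResidueMap

end Literature.NumberTheory.Automorphic

end
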